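import Summits.RiemannHypothesis.RiemannHypothesis.Theorems.WeilGroundStateGroundStatesConvergeToXiRenormLowerBound
import Literature.NumberTheory.LFunctions.RiemannXiHadamardProduct
import Literature.Analysis.Complex.Hurwitz
import HarnessLib

/-!
# `WeilGroundState.GroundStatesConvergeToXi` — node locking is necessary (crux item
stmt-RiemannHypothesis-1527, route route-RiemannHypothesis-WeilGroundState; line `Sketch`, lead c5;
`--supports`)

RH-free.  Along every witness of the crux's convergence clause (`u_k` ground states,
`c_k · weilMellin u_k → ξ` locally uniformly on the open critical strip) the zero set of the
ground-state transforms `û_k = weilMellin u_k` converges to the zero set of `ξ` inside the strip: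

* `eventually_exists_zero_near_of_riemannXi_eq_zero` — **every zero of `ξ` in the open strip
  attracts zeros of `û_k`**: for every `ρ` with `ξ(ρ) = 0`, `0 < Re ρ < 1`, and every `r > 0`,
  eventually `û_k` vanishes somewhere in the disc `B(ρ, r)` (Hurwitz, existence half:
  `Complex.eventually_exists_zero_mem_ball_of_tendstoUniformlyOn`; zeros of `ξ` are isolated since
  `ξ(0) = 1/2`; `c_k ≠ 0` eventually since `c_k û_k(1/2) → ξ(1/2) ≠ 0`);
* `eventually_forall_ne_zero_of_riemannXi_ne_zero` — **and nothing else does**: on every compact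
  `K` of the strip on which `ξ` has no zero, eventually `û_k` has no zero.
So the "node locking" of the crux numerics (r1-k2 Finding 4: the first ten zeros of `û_a` agree
with the zeta ordinates to `≤ 1e-18` at `a = 1.24`) is a NECESSARY consequence of the crux, for the
zeros of `ζ` in the open strip (`riemannXi_eq_zero_iff_holds`), on or off the critical line.
No new definitions.
-/

noncomputable section

set_option linter.dupNamespace false

open scoped Topology Real
open Filter Set MeasureTheory Complex Metric

namespace Summit.RiemannHypothesis.RiemannHypothesis.Theorems.GroundStatesConvergeToXi

open Literature.NumberTheory.LFunctions

/-- **Zeros of `ξ` are isolated**: around every `ρ` there is a punctured closed disc free of zeros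
of `ξ` (`ξ` is entire and not identically zero, `ξ(0) = 1/2`). [folklore] -/
theorem exists_ball_riemannXi_ne_zero (ρ : ℂ) :
    ∃ r₀ : ℝ, 0 < r₀ ∧ ∀ z ∈ closedBall ρ r₀, z ≠ ρ → riemannXi z ≠ 0 := by
  have han : AnalyticOnNhd ℂ riemannXi univ :=
    differentiable_riemannXi.differentiableOn.analyticOnNhd isOpen_univ
  have hρ : AnalyticAt ℂ riemannXi ρ := han ρ (mem_univ _)
  rcases hρ.eventually_eq_zero_or_eventually_ne_zero with h | h
  · exfalso
    have hall := han.eqOn_zero_of_preconnected_of_eventuallyEq_zero isPreconnected_univ (mem_univ ρ) h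
    have h0 := hall (mem_univ (0 : ℂ))
    rw [riemannXi_zero] at h0
    norm_num at h0
  · obtain ⟨ε, hε, hball⟩ := Metric.eventually_nhds_iff.1 (eventually_nhdsWithin_iff.1 h)
    refine ⟨ε / 2, by positivity, fun z hz hzρ => ?_⟩
    have hz' : dist z ρ < ε := lt_of_le_of_lt (mem_closedBall.1 hz) (by linarith)
    exact hball hz' (by simpa using hzρ)

/-- Eventually `c_k ≠ 0` along a witness of the convergence clause (`c_k ∫u_k → ξ(1/2) ≠ 0`).
[folklore] -/
theorem eventually_renorm_ne_zero {u : ℕ → ℝ → ℂ} {c : ℕ → ℂ}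
    (hlim : TendstoLocallyUniformlyOn (fun k s => c k * weilMellin (u k) s) riemannXi atTop
      {s : ℂ | 0 < s.re ∧ s.re < 1}) :
    ∀ᶠ k in atTop, c k ≠ 0 := by
  filter_upwards [(tendsto_renorm_integral hlim).eventually_ne riemannXi_one_half_ne_zero] with k hk
  exact left_ne_zero_of_mul hk

/-! ## Every zero of `ξ` in the strip attracts zeros of the ground-state transforms -/

/-- **Node locking is necessary (RH-free).**  Let `u_k` be ground states and `c_k` scalars with
`c_k · weilMellin u_k → ξ` locally uniformly on the open strip.  For every zero `ρ` of `ξ` in the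
open strip and every `r > 0`, eventually the entire function `û_k = weilMellin u_k` has a zero in
the disc `B(ρ, r)`.  (Shrink `r` below the isolation radius of `ρ` and inside the strip; uniform
convergence on the closed disc; Hurwitz's theorem, existence half, for `c_k û_k`; divide by
`c_k ≠ 0`.) [folklore] -/
theorem eventually_exists_zero_near_of_riemannXi_eq_zero {a : ℕ → ℝ} {u : ℕ → ℝ → ℂ} {c : ℕ → ℂ}
    (hu : ∀ k, IsWeilGroundState (a k) (u k))
    (hlim : TendstoLocallyUniformlyOn (fun k s => c k * weilMellin (u k) s) riemannXi atTop
      {s : ℂ | 0 < s.re ∧ s.re < 1})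
    {ρ : ℂ} (hρ : riemannXi ρ = 0) (hstrip : 0 < ρ.re ∧ ρ.re < 1) {r : ℝ} (hr : 0 < r) :
    ∀ᶠ k in atTop, ∃ z ∈ ball ρ r, weilMellin (u k) z = 0 := by
  obtain ⟨r₀, hr₀, hiso⟩ := exists_ball_riemannXi_ne_zero ρ
  -- a radius `r'` below `r`, `r₀` and the distance to the boundary of the strip
  set d : ℝ := min ρ.re (1 - ρ.re) with hddef
  have hd : 0 < d := lt_min hstrip.1 (by linarith [hstrip.2])
  set r' : ℝ := min (min r r₀) (d / 2) with hr'def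
  have hr' : 0 < r' := by positivity
  have hr'r : r' ≤ r := (min_le_left _ _).trans (min_le_left _ _)
  have hr'r₀ : r' ≤ r₀ := (min_le_left _ _).trans (min_le_right _ _)
  have hr'd : r' ≤ d / 2 := min_le_right _ _
  have hsub : closedBall ρ r' ⊆ {s : ℂ | 0 < s.re ∧ s.re < 1} := by
    intro z hz
    have h1 : |(z - ρ).re| ≤ ‖z - ρ‖ := abs_re_le_norm _
    have h2 : ‖z - ρ‖ ≤ r' := by rwa [mem_closedBall, dist_eq_norm] at hz
    have h3 : |z.re - ρ.re| ≤ d / 2 := by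
      rw [show z.re - ρ.re = (z - ρ).re by simp]; linarith
    have hd1 : d ≤ ρ.re := min_le_left _ _
    have hd2 : d ≤ 1 - ρ.re := min_le_right _ _
    rw [abs_le] at h3
    constructor
    · show 0 < z.re
      linarith
    · show z.re < 1
      linarith
  -- uniform convergence on the closed disc and Hurwitz
  have hunif : TendstoUniformlyOn (fun k s => c k * weilMellin (u k) s) riemannXi atTop (closedBall ρ r') :=
    (tendstoLocallyUniformlyOn_iff_forall_isCompact ((isOpen_lt continuous_const Complex.continuous_re).inter
      (isOpen_lt Complex.continuous_re continuous_const))).1 hlim _ hsub (isCompact_closedBall _ _)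
  have hF : ∀ᶠ k in atTop, DiffContOnCl ℂ (fun s => c k * weilMellin (u k) s) (ball ρ r') :=
    Eventually.of_forall fun k => ((hu k).differentiable_weilMellin.const_mul (c k)).diffContOnCl
  have hsphere : ∀ z ∈ sphere ρ r', riemannXi z ≠ 0 := by
    intro z hz
    have hz1 : z ∈ closedBall ρ r₀ := closedBall_subset_closedBall hr'r₀ (sphere_subset_closedBall hz)
    have hz2 : z ≠ ρ := by
      intro h
      rw [h, mem_sphere, dist_self] at hz
      exact hr'.ne' hz.symm
    exact hiso z hz1 hz2
  have hH := Complex.eventually_exists_zero_mem_ball_of_tendstoUniformlyOn hr' hF hunif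
    differentiable_riemannXi.continuous.continuousOn hρ hsphere
  filter_upwards [hH, eventually_renorm_ne_zero hlim] with k hk hck
  obtain ⟨z, hz, hz0⟩ := hk
  exact ⟨z, ball_subset_ball hr'r hz, (mul_eq_zero.1 hz0).resolve_left hck⟩

/-- **Node locking at the zeros of `ζ`** (the same, for non-trivial zeros of `ζ` in the open strip,
through `riemannXi_eq_zero_iff_holds`): for every `ρ` with `ζ(ρ) = 0`, `0 < Re ρ < 1`, and every
`r > 0`, eventually `û_k` vanishes somewhere in `B(ρ, r)`. [folklore] -/
theorem eventually_exists_zero_near_zetaZero {a : ℕ → ℝ} {u : ℕ → ℝ → ℂ} {c : ℕ → ℂ}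
    (hu : ∀ k, IsWeilGroundState (a k) (u k))
    (hlim : TendstoLocallyUniformlyOn (fun k s => c k * weilMellin (u k) s) riemannXi atTop
      {s : ℂ | 0 < s.re ∧ s.re < 1})
    {ρ : ℂ} (hζ : riemannZeta ρ = 0) (hstrip : 0 < ρ.re ∧ ρ.re < 1) {r : ℝ} (hr : 0 < r) :
    ∀ᶠ k in atTop, ∃ z ∈ ball ρ r, weilMellin (u k) z = 0 :=
  eventually_exists_zero_near_of_riemannXi_eq_zero hu hlim
    ((riemannXi_eq_zero_iff_holds ρ).2 ⟨hζ, hstrip.1, hstrip.2⟩) hstrip hr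

/-! ## … and nothing else attracts zeros -/

/-- **No spurious zeros (RH-free).**  On every compact subset `K` of the open strip on which `ξ`
has no zero, eventually `û_k` has no zero (uniform convergence and `min_K |ξ| > 0`). [folklore] -/
theorem eventually_forall_ne_zero_of_riemannXi_ne_zero {u : ℕ → ℝ → ℂ} {c : ℕ → ℂ}
    (hlim : TendstoLocallyUniformlyOn (fun k s => c k * weilMellin (u k) s) riemannXi atTop
      {s : ℂ | 0 < s.re ∧ s.re < 1})
    {K : Set ℂ} (hK : IsCompact K) (hKs : K ⊆ {s : ℂ | 0 < s.re ∧ s.re < 1})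
    (hξ : ∀ z ∈ K, riemannXi z ≠ 0) :
    ∀ᶠ k in atTop, ∀ z ∈ K, weilMellin (u k) z ≠ 0 := by
  rcases K.eq_empty_or_nonempty with hKe | hne
  · exact Eventually.of_forall fun k z hz => by simp [hKe] at hz
  obtain ⟨w, hw, hmin⟩ := hK.exists_isMinOn hne differentiable_riemannXi.continuous.continuousOn.norm
  set δ : ℝ := ‖riemannXi w‖ with hδdef
  have hδ : 0 < δ := norm_pos_iff.2 (hξ w hw)
  have hunif : TendstoUniformlyOn (fun k s => c k * weilMellin (u k) s) riemannXi atTop K :=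
    (tendstoLocallyUniformlyOn_iff_forall_isCompact ((isOpen_lt continuous_const Complex.continuous_re).inter
      (isOpen_lt Complex.continuous_re continuous_const))).1 hlim _ hKs hK
  filter_upwards [Metric.tendstoUniformlyOn_iff.1 hunif δ hδ] with k hk z hz h0
  have h1 := hk z hz
  rw [h0, mul_zero, dist_zero_right] at h1
  exact (not_lt.2 (hmin hz)) h1

end Summit.RiemannHypothesis.RiemannHypothesis.Theorems.GroundStatesConvergeToXi

end
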